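import Summits.CriticalPhenomena.PercolationContinuityZ3.Theorems.PercNearOneGluingNoHeavyLowerTailGiantKnStep
import Summits.CriticalPhenomena.PercolationContinuityZ3.Theorems.PercNearOneGluingNoHeavyLowerTailGiantKnPatterns
import Summits.CriticalPhenomena.PercolationContinuityZ3.Theorems.PercNearOneGluingNoHeavyLowerTailOwnDisconnection
import Summits.CriticalPhenomena.PercolationContinuityZ3.Theorems.PercNearOneGluingAdditiveGluingKnLemma2General
import HarnessLib

/-!
# `NoHeavyLowerTail` (stmt-CriticalPhenomena-4575) — the k-fold giant Kozma–Nitzan theorem: `XZ_T` in the fully-clustered regime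

Support file (prover `prim-lf-7`, lemma factory "k-cluster conditional association"; `--supports stmt-CriticalPhenomena-4575`).
No definitions, no named facts, no sorries.

Setting: `μ = prodBernoulli w` on `Fin n`, relays `A` on the ladder `|A| ≤ 2j+1` (one heavy cluster `Γ`), heavy `:= j+1 ≤ |π(v)|`.
Point set `S = insert c T` (`c ∉ T`; the case `T = A∖{c}`, `c` the champion, is the crux residual `XZ = CST`:
`μ(1 ≤ N ≤ j, c heavy) ≤ μ(N ≥ j+1, c light)`).  Trace pattern of `B ⊆ T`: `{∀ s ∈ S, s heavy ↔ s ∈ B}`; co-pattern: `… ↔ s ∈ S∖B`.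

* `GiantKn.patternStep` — for `∅ ≠ B ⊆ T`: `[μ(pattern B, o↔B) − μ(pattern S∖B, o↔B)]·μ(B ↮ S∖B) ≥ μ(B ↮ S∖B, o↔B)·[μ(pattern B) − μ(pattern S∖B)]`
  (`giant_knStep` for the split `(B, S∖B)`; Kozma–Nitzan's "6 applications of BHK", for any number of points).
* `GiantKn.xzT_of_clustered` — THE THEOREM: if `μ(x light) ≤ μ(c light)` for `x ∈ T`, the points of `S` are simultaneously separable with
  positive probability, and `μ(pattern S∖B) ≤ μ(pattern B)` for every `B ⊆ T` with `|B| ≥ 2` ("fully clustered"; for `|T| = 2` this is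
  exactly KN's hypothesis `m₃ ≤ m₁₂` of Theorem 2), then `μ(o↔T, o light, c heavy) ≤ μ(o↔T, o heavy, c light)`.
  Assembly: `attachedHeavy/Light_eq_sum` (exact pattern decomposition) + `patternStep` + `knK_lemma2` (push non-singleton terms to
  singletons) + `sum_pattern_eq − sum_copattern_eq = μ(L_c) − μ(L_x)` (telescoping).  The argument yields the quantitative bound
  `slack ≥ Σ_{x∈T} φ_x (μ(L_c) − μ(L_x))`, conjectured regime-free (prim-lf-7 CANDIDATES batch 7, `KNB_T`: 0 violations / 50 k instances).
[cite: KozmaNitzan2024, Thm. 2 (pp. 8–9) and Lemma 2 (p. 6); VandenbergHaggstromKahn2005, Thm. 2.1]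
-/

noncomputable section

namespace Summit.CriticalPhenomena.PercolationContinuityZ3.Theorems

open MeasureTheory Set Literature.Probability.LatticeModels Literature.Probability.Percolation
open scoped Classical BigOperators

variable {n : ℕ}

namespace GiantKn

/-- **Per-pattern KN step on the ladder (PROVED).**  `S = insert c T`, `c ∉ T`, `∅ ≠ B ⊆ T`, `D_B = {B ↮ S∖B}`, `Att_B = {o ↔ B}`:
`[μ(pattern B, o↔B) − μ(pattern S∖B, o↔B)] · μ(D_B) ≥ μ(D_B, o↔B) · [μ(pattern B) − μ(pattern S∖B)]`
— `giant_knStep` for the split `(B, S∖B)` with its four events identified as trace patterns (ladder `|A| ≤ 2j+1`).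
[cite: KozmaNitzan2024, proof of Thm. 2 (pp. 8–9); VandenbergHaggstromKahn2005, Thm. 2.1] -/
theorem patternStep (w : Sym2 (Fin n) → unitInterval) (A S T B : Finset (Fin n)) (o c : Fin n) (j : ℕ)
    (hA : A.card ≤ 2 * j + 1) (hS : S = insert c T) (hc : c ∉ T) (hBT : B ⊆ T) (hB : B.Nonempty) :
    ((prodBernoulli w).real ({ω : BondConfig (Fin n) | ∀ s ∈ S, (j + 1 ≤ (A.filter fun a => ω ∈ openConn s a).card ↔ s ∈ B)} ∩
          ⋃ s ∈ B, (openConn s o : Set (BondConfig (Fin n)))) -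
        (prodBernoulli w).real ({ω : BondConfig (Fin n) | ∀ s ∈ S, (j + 1 ≤ (A.filter fun a => ω ∈ openConn s a).card ↔ s ∈ S \ B)} ∩
          ⋃ s ∈ B, (openConn s o : Set (BondConfig (Fin n))))) *
      (prodBernoulli w).real {ω : BondConfig (Fin n) | ∀ s ∈ B, ∀ t ∈ S \ B, ¬ (openGraph ω).Reachable s t} ≥
    (prodBernoulli w).real ({ω : BondConfig (Fin n) | ∀ s ∈ B, ∀ t ∈ S \ B, ¬ (openGraph ω).Reachable s t} ∩
          ⋃ s ∈ B, (openConn s o : Set (BondConfig (Fin n)))) *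
      ((prodBernoulli w).real {ω : BondConfig (Fin n) | ∀ s ∈ S, (j + 1 ≤ (A.filter fun a => ω ∈ openConn s a).card ↔ s ∈ B)} -
        (prodBernoulli w).real {ω : BondConfig (Fin n) | ∀ s ∈ S, (j + 1 ≤ (A.filter fun a => ω ∈ openConn s a).card ↔ s ∈ S \ B)}) := by
  obtain ⟨card_eq, lh, ladder⟩ := toolkit A j hA
  have hTS : T ⊆ S := by rw [hS]; exact Finset.subset_insert c T
  have hBS : B ⊆ S := hBT.trans hTS
  have hcS : c ∈ S := by rw [hS]; exact Finset.mem_insert_self c T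
  have hcSB : c ∈ S \ B := Finset.mem_sdiff.2 ⟨hcS, fun h => hc (hBT h)⟩
  obtain ⟨b, hb⟩ := hB
  have k := giant_knStep w A (↑B : Set (Fin n)) (↑(S \ B) : Set (Fin n)) o j
  -- the events of `giant_knStep`, in Finset-binder form
  have eD : {ω : BondConfig (Fin n) | ∀ s ∈ (↑B : Set (Fin n)), ∀ t ∈ (↑(S \ B) : Set (Fin n)), ¬ (openGraph ω).Reachable s t} =
      {ω : BondConfig (Fin n) | ∀ s ∈ B, ∀ t ∈ S \ B, ¬ (openGraph ω).Reachable s t} := by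
    ext ω; simp only [mem_setOf_eq, Finset.mem_coe]
  have eAtt : (⋃ s ∈ (↑B : Set (Fin n)), (openConn s o : Set (BondConfig (Fin n)))) = ⋃ s ∈ B, (openConn s o : Set (BondConfig (Fin n))) := by
    ext ω; simp only [mem_iUnion, Finset.mem_coe]
  rw [eD, eAtt] at k
  -- pattern identifications (ladder)
  have e3 : ({ω : BondConfig (Fin n) | ∀ s ∈ B, ∀ t ∈ S \ B, ¬ (openGraph ω).Reachable s t} ∩
        {ω | ∀ s ∈ (↑B : Set (Fin n)), j + 1 ≤ (A.filter fun a => ω ∈ openConn s a).card}) =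
      {ω : BondConfig (Fin n) | ∀ s ∈ S, (j + 1 ≤ (A.filter fun a => ω ∈ openConn s a).card ↔ s ∈ B)} := by
    ext ω
    simp only [mem_inter_iff, mem_setOf_eq, Finset.mem_coe]
    constructor
    · rintro ⟨hD, hH⟩ s hs
      constructor
      · intro hh
        by_contra hsB
        have hst : s ∈ S \ B := Finset.mem_sdiff.2 ⟨hs, hsB⟩
        have := ladder (fun h => hD b hb s hst h.symm) (hH b hb)
        omega
      · intro hsB; exact hH s hsB
    · intro hpat
      refine ⟨fun s hs t ht h => ?_, fun s hs => (hpat s (hBS hs)).2 hs⟩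
      have hsh := (hpat s (hBS hs)).2 hs
      have htl : ¬ (j + 1 ≤ (A.filter fun a => ω ∈ openConn t a).card) := fun hth => (Finset.mem_sdiff.1 ht).2 ((hpat t (Finset.mem_sdiff.1 ht).1).1 hth)
      exact lh (by omega) hsh h.symm
  have e4 : ({ω : BondConfig (Fin n) | ∀ s ∈ B, ∀ t ∈ S \ B, ¬ (openGraph ω).Reachable s t} ∩
        {ω | ∀ t ∈ (↑(S \ B) : Set (Fin n)), j + 1 ≤ (A.filter fun a => ω ∈ openConn t a).card}) =
      {ω : BondConfig (Fin n) | ∀ s ∈ S, (j + 1 ≤ (A.filter fun a => ω ∈ openConn s a).card ↔ s ∈ S \ B)} := by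
    ext ω
    simp only [mem_inter_iff, mem_setOf_eq, Finset.mem_coe]
    constructor
    · rintro ⟨hD, hH⟩ s hs
      constructor
      · intro hh
        by_contra hsSB
        have hsB : s ∈ B := by
          by_contra hsB; exact hsSB (Finset.mem_sdiff.2 ⟨hs, hsB⟩)
        have := ladder (hD s hsB c hcSB) (hH c hcSB)
        omega
      · intro hsSB; exact hH s hsSB
    · intro hpat
      refine ⟨fun s hs t ht h => ?_, fun t ht => (hpat t (Finset.mem_sdiff.1 ht).1).2 ht⟩
      have hth := (hpat t (Finset.mem_sdiff.1 ht).1).2 ht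
      have hsl : ¬ (j + 1 ≤ (A.filter fun a => ω ∈ openConn s a).card) := fun hsh =>
        (Finset.mem_sdiff.1 ((hpat s (hBS hs)).1 hsh)).2 hs
      exact lh (by omega) hth h
  have e1 : ({ω : BondConfig (Fin n) | ∀ s ∈ B, ∀ t ∈ S \ B, ¬ (openGraph ω).Reachable s t} ∩
        ((⋃ s ∈ B, (openConn s o : Set (BondConfig (Fin n)))) ∩ {ω | ∀ s ∈ (↑B : Set (Fin n)), j + 1 ≤ (A.filter fun a => ω ∈ openConn s a).card})) =
      {ω : BondConfig (Fin n) | ∀ s ∈ S, (j + 1 ≤ (A.filter fun a => ω ∈ openConn s a).card ↔ s ∈ B)} ∩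
          ⋃ s ∈ B, (openConn s o : Set (BondConfig (Fin n))) := by
    rw [← e3]; ext ω; simp only [mem_inter_iff]; tauto
  have e2 : ({ω : BondConfig (Fin n) | ∀ s ∈ B, ∀ t ∈ S \ B, ¬ (openGraph ω).Reachable s t} ∩
        ((⋃ s ∈ B, (openConn s o : Set (BondConfig (Fin n)))) ∩ {ω | ∀ t ∈ (↑(S \ B) : Set (Fin n)), j + 1 ≤ (A.filter fun a => ω ∈ openConn t a).card})) =
      {ω : BondConfig (Fin n) | ∀ s ∈ S, (j + 1 ≤ (A.filter fun a => ω ∈ openConn s a).card ↔ s ∈ S \ B)} ∩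
          ⋃ s ∈ B, (openConn s o : Set (BondConfig (Fin n))) := by
    rw [← e4]; ext ω; simp only [mem_inter_iff]; tauto
  rw [e1, e2, e3, e4] at k
  exact k


/-- **The k-fold giant Kozma–Nitzan theorem (PROVED): `XZ_T` in the fully-clustered regime.**  Ladder `|A| ≤ 2j+1`, `S = insert c T`
(`c ∉ T`), every `x ∈ T` at most as light as `c` (`μ(x light) ≤ μ(c light)`), the points of `S` simultaneously separable with positive
probability, and the regime `μ(pattern S∖B) ≤ μ(pattern B)` for every `B ⊆ T` with `|B| ≥ 2` (for `|T| = 2` this is KN's hypothesis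
`m₃ ≤ m₁₂`).  Then the attached-champion inequality with attachment set `T` holds:
`μ(o ↔ T, o light, c heavy) ≤ μ(o ↔ T, o heavy, c light)`.
Proof (prim-lf-7 BLUEPRINT-KNB): break both sides by trace patterns (`attachedHeavy/Light_eq_sum`), bound each difference by `patternStep`,
push every non-singleton term down to singletons with `knK_lemma2` (KN Lemma 2, any number of points) using the regime, and telescope with
`sum_pattern_eq − sum_copattern_eq = μ(c light) − μ(x light) ≥ 0`.  In fact the proof gives `slack ≥ Σ_{x∈T} φ_x (μ(L_c) − μ(L_x))`.
[cite: KozmaNitzan2024, Thm. 2 (pp. 8–9), Lemma 2 (p. 6); VandenbergHaggstromKahn2005, Thm. 2.1] -/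
theorem xzT_of_clustered (w : Sym2 (Fin n) → unitInterval) (A S T : Finset (Fin n)) (o c : Fin n) (j : ℕ)
    (hA : A.card ≤ 2 * j + 1) (hS : S = insert c T) (hc : c ∉ T)
    (hr : ∀ x ∈ T, (prodBernoulli w).real {ω : BondConfig (Fin n) | (A.filter fun a => ω ∈ openConn x a).card ≤ j} ≤
      (prodBernoulli w).real {ω : BondConfig (Fin n) | (A.filter fun a => ω ∈ openConn c a).card ≤ j})
    (hM : 0 < (prodBernoulli w).real {ω : BondConfig (Fin n) | ∀ k ∈ S, ∀ l ∈ S, k ≠ l → ¬ (openGraph ω).Reachable k l})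
    (hreg : ∀ B, B ⊆ T → 2 ≤ B.card →
      (prodBernoulli w).real {ω : BondConfig (Fin n) | ∀ s ∈ S, (j + 1 ≤ (A.filter fun a => ω ∈ openConn s a).card ↔ s ∈ S \ B)} ≤
        (prodBernoulli w).real {ω : BondConfig (Fin n) | ∀ s ∈ S, (j + 1 ≤ (A.filter fun a => ω ∈ openConn s a).card ↔ s ∈ B)}) :
    (prodBernoulli w).real ((⋃ t ∈ T, (openConn o t : Set (BondConfig (Fin n)))) ∩
        {ω | (A.filter fun a => ω ∈ openConn o a).card ≤ j} ∩ {ω | j + 1 ≤ (A.filter fun a => ω ∈ openConn c a).card}) ≤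
      (prodBernoulli w).real ((⋃ t ∈ T, (openConn o t : Set (BondConfig (Fin n)))) ∩
        {ω | j + 1 ≤ (A.filter fun a => ω ∈ openConn o a).card} ∩ {ω | (A.filter fun a => ω ∈ openConn c a).card ≤ j}) := by
  rw [attachedLight_eq_sum w A S T o c j hS hc, attachedHeavy_eq_sum w A S T o c j hS hc]
  set μ := prodBernoulli w with hμ
  have hTS : T ⊆ S := by rw [hS]; exact Finset.subset_insert c T
  have hcS : c ∈ S := by rw [hS]; exact Finset.mem_insert_self c T
  set I := T.powerset.filter (fun B => B.Nonempty) with hI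
  -- the functions of B
  set P : Finset (Fin n) → ℝ := fun B => μ.real ({ω : BondConfig (Fin n) | ∀ s ∈ S, (j + 1 ≤ (A.filter fun a => ω ∈ openConn s a).card ↔ s ∈ B)} ∩
      ⋃ s ∈ B, (openConn s o : Set (BondConfig (Fin n)))) with hP
  set N : Finset (Fin n) → ℝ := fun B => μ.real ({ω : BondConfig (Fin n) | ∀ s ∈ S, (j + 1 ≤ (A.filter fun a => ω ∈ openConn s a).card ↔ s ∈ S \ B)} ∩
      ⋃ s ∈ B, (openConn s o : Set (BondConfig (Fin n)))) with hN
  set m : Finset (Fin n) → ℝ := fun B => μ.real {ω : BondConfig (Fin n) | ∀ s ∈ S, (j + 1 ≤ (A.filter fun a => ω ∈ openConn s a).card ↔ s ∈ B)} with hm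
  set mb : Finset (Fin n) → ℝ := fun B => μ.real {ω : BondConfig (Fin n) | ∀ s ∈ S, (j + 1 ≤ (A.filter fun a => ω ∈ openConn s a).card ↔ s ∈ S \ B)} with hmb
  set d : Finset (Fin n) → ℝ := fun B => μ.real {ω : BondConfig (Fin n) | ∀ s ∈ B, ∀ t ∈ S \ B, ¬ (openGraph ω).Reachable s t} with hd
  set av : Finset (Fin n) → ℝ := fun B => μ.real ({ω : BondConfig (Fin n) | ∀ s ∈ B, ∀ t ∈ S \ B, ¬ (openGraph ω).Reachable s t} ∩
      ⋃ s ∈ B, (openConn s o : Set (BondConfig (Fin n)))) with hav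
  set φ : Finset (Fin n) → ℝ := fun B => av B / d B with hφ
  change ∑ B ∈ I, N B ≤ ∑ B ∈ I, P B
  -- positivity of the separation events
  have hdpos : ∀ B, B ⊆ S → 0 < d B := by
    intro B hBS
    refine lt_of_lt_of_le hM (measureReal_mono ?_ (measure_ne_top _ _))
    intro ω hω s hs t ht
    exact hω s (hBS hs) t (Finset.mem_sdiff.1 ht).1 (fun h => (Finset.mem_sdiff.1 ht).2 (h ▸ hs))
  -- step 1: per-pattern KN step
  have step1 : ∀ B ∈ I, φ B * (m B - mb B) ≤ P B - N B := by
    intro B hB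
    rw [hI, Finset.mem_filter, Finset.mem_powerset] at hB
    have k := patternStep w A S T B o c j hA hS hc hB.1 hB.2
    change (P B - N B) * d B ≥ av B * (m B - mb B) at k
    have hdB := hdpos B (hB.1.trans hTS)
    show av B / d B * (m B - mb B) ≤ P B - N B
    rw [div_mul_eq_mul_div, div_le_iff₀ hdB]; linarith
  -- step 2: Lemma 2 pushes non-singleton terms down (regime), singletons unchanged
  have eDsingle : ∀ x ∈ S, {ω : BondConfig (Fin n) | ∀ s ∈ ({x} : Finset (Fin n)), ∀ t ∈ S \ {x}, ¬ (openGraph ω).Reachable s t} =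
      {ω : BondConfig (Fin n) | ∀ x' ∈ S.erase x, ¬ (openGraph ω).Reachable x x'} := by
    intro x _; ext ω; simp only [mem_setOf_eq, Finset.mem_singleton, forall_eq, Finset.sdiff_singleton_eq_erase]
  have eAsingle : ∀ x : Fin n, (⋃ s ∈ ({x} : Finset (Fin n)), (openConn s o : Set (BondConfig (Fin n)))) = openConn x o := by
    intro x; ext ω; simp only [mem_iUnion, Finset.mem_singleton, exists_prop, exists_eq_left]
  have eDcoe : ∀ B : Finset (Fin n), {ω : BondConfig (Fin n) | ∀ s ∈ B, ∀ x' ∈ (↑(S \ B) : Set (Fin n)), ¬ (openGraph ω).Reachable s x'} =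
      {ω : BondConfig (Fin n) | ∀ s ∈ B, ∀ t ∈ S \ B, ¬ (openGraph ω).Reachable s t} := by
    intro B; ext ω; simp only [mem_setOf_eq, Finset.mem_coe]
  have hφsingle : ∀ x ∈ S, φ {x} = μ.real ({ω : BondConfig (Fin n) | ∀ x' ∈ S.erase x, ¬ (openGraph ω).Reachable x x'} ∩ openConn x o) /
      μ.real {ω : BondConfig (Fin n) | ∀ x' ∈ S.erase x, ¬ (openGraph ω).Reachable x x'} := by
    intro x hx
    show μ.real ({ω : BondConfig (Fin n) | ∀ s ∈ ({x} : Finset (Fin n)), ∀ t ∈ S \ {x}, ¬ (openGraph ω).Reachable s t} ∩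
        ⋃ s ∈ ({x} : Finset (Fin n)), (openConn s o : Set (BondConfig (Fin n)))) /
      μ.real {ω : BondConfig (Fin n) | ∀ s ∈ ({x} : Finset (Fin n)), ∀ t ∈ S \ {x}, ¬ (openGraph ω).Reachable s t} = _
    rw [eDsingle x hx, eAsingle x]
  have hL2 : ∀ B, B ⊆ T → ∑ x ∈ B, φ {x} ≤ φ B := by
    intro B hBT
    have hBS : B ⊆ S := hBT.trans hTS
    have hMB : 0 < μ.real {ω : BondConfig (Fin n) | ∀ k ∈ B, ∀ l ∈ S, k ≠ l → ¬ (openGraph ω).Reachable k l} :=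
      lt_of_lt_of_le hM (measureReal_mono (fun ω hω k hk l hl hkl => hω k (hBS hk) l hl hkl) (measure_ne_top _ _))
    have h := knK_lemma2 w o S B hBS hMB
    rw [eDcoe B] at h
    rw [Finset.sum_congr rfl (fun x hx => hφsingle x (hBS hx))]
    exact h
  have step2 : ∀ B ∈ I, (∑ x ∈ B, φ {x}) * (m B - mb B) ≤ φ B * (m B - mb B) := by
    intro B hB
    rw [hI, Finset.mem_filter, Finset.mem_powerset] at hB
    by_cases h1 : B.card = 1
    · obtain ⟨x, rfl⟩ := Finset.card_eq_one.1 h1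
      rw [Finset.sum_singleton]
    · have h2 : 2 ≤ B.card := by have := Finset.card_pos.2 hB.2; omega
      exact mul_le_mul_of_nonneg_right (hL2 B hB.1) (by have := hreg B hB.1 h2; linarith)
  -- step 3: swap the sums
  have step3 : ∑ B ∈ I, (∑ x ∈ B, φ {x}) * (m B - mb B) =
      ∑ x ∈ T, φ {x} * ∑ B ∈ T.powerset.filter (fun B => x ∈ B), (m B - mb B) := by
    have e1 : ∀ B ∈ I, (∑ x ∈ B, φ {x}) * (m B - mb B) = ∑ x ∈ T, (if x ∈ B then φ {x} * (m B - mb B) else 0) := by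
      intro B hB
      rw [hI, Finset.mem_filter, Finset.mem_powerset] at hB
      rw [Finset.sum_mul, ← Finset.sum_filter]
      congr 1
      ext y; simp only [Finset.mem_filter]; exact ⟨fun h => ⟨hB.1 h, h⟩, fun h => h.2⟩
    rw [Finset.sum_congr rfl e1, Finset.sum_comm]
    refine Finset.sum_congr rfl fun x hx => ?_
    rw [Finset.mul_sum, ← Finset.sum_filter]
    congr 1
    ext B
    simp only [hI, Finset.mem_filter, Finset.mem_powerset]
    exact ⟨fun h => ⟨h.1.1, h.2⟩, fun h => ⟨⟨h.1, ⟨x, h.2⟩⟩, h.2⟩⟩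
  -- step 4: telescoping
  have step4 : ∀ x ∈ T, ∑ B ∈ T.powerset.filter (fun B => x ∈ B), (m B - mb B) =
      μ.real {ω : BondConfig (Fin n) | (A.filter fun a => ω ∈ openConn c a).card ≤ j} -
        μ.real {ω : BondConfig (Fin n) | (A.filter fun a => ω ∈ openConn x a).card ≤ j} := by
    intro x hx
    rw [Finset.sum_sub_distrib]
    change ∑ B ∈ T.powerset.filter (fun B => x ∈ B), μ.real {ω : BondConfig (Fin n) | ∀ s ∈ S, (j + 1 ≤ (A.filter fun a => ω ∈ openConn s a).card ↔ s ∈ B)} -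
        ∑ B ∈ T.powerset.filter (fun B => x ∈ B), μ.real {ω : BondConfig (Fin n) | ∀ s ∈ S, (j + 1 ≤ (A.filter fun a => ω ∈ openConn s a).card ↔ s ∈ S \ B)} = _
    rw [sum_pattern_eq w A S T c x j hS hc hx, sum_copattern_eq w A S T c x j hS hc hx]
    have s1 := OwnDisconnection.split w {ω : BondConfig (Fin n) | (A.filter fun a => ω ∈ openConn c a).card ≤ j}
      {ω : BondConfig (Fin n) | j + 1 ≤ (A.filter fun a => ω ∈ openConn x a).card}
    have s2 := OwnDisconnection.split w {ω : BondConfig (Fin n) | (A.filter fun a => ω ∈ openConn x a).card ≤ j}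
      {ω : BondConfig (Fin n) | j + 1 ≤ (A.filter fun a => ω ∈ openConn c a).card}
    have c1 : ({ω : BondConfig (Fin n) | j + 1 ≤ (A.filter fun a => ω ∈ openConn x a).card}ᶜ : Set (BondConfig (Fin n))) =
        {ω | (A.filter fun a => ω ∈ openConn x a).card ≤ j} := by ext ω; simp only [mem_compl_iff, mem_setOf_eq, not_le]; omega
    have c2 : ({ω : BondConfig (Fin n) | j + 1 ≤ (A.filter fun a => ω ∈ openConn c a).card}ᶜ : Set (BondConfig (Fin n))) =
        {ω | (A.filter fun a => ω ∈ openConn c a).card ≤ j} := by ext ω; simp only [mem_compl_iff, mem_setOf_eq, not_le]; omega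
    rw [c1] at s1; rw [c2] at s2
    have i1 : ({ω : BondConfig (Fin n) | (A.filter fun a => ω ∈ openConn c a).card ≤ j} ∩ {ω | j + 1 ≤ (A.filter fun a => ω ∈ openConn x a).card} :
        Set (BondConfig (Fin n))) = {ω | j + 1 ≤ (A.filter fun a => ω ∈ openConn x a).card} ∩ {ω | (A.filter fun a => ω ∈ openConn c a).card ≤ j} :=
      inter_comm _ _
    have i2 : ({ω : BondConfig (Fin n) | (A.filter fun a => ω ∈ openConn x a).card ≤ j} ∩ {ω | j + 1 ≤ (A.filter fun a => ω ∈ openConn c a).card} :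
        Set (BondConfig (Fin n))) = {ω | j + 1 ≤ (A.filter fun a => ω ∈ openConn c a).card} ∩ {ω | (A.filter fun a => ω ∈ openConn x a).card ≤ j} :=
      inter_comm _ _
    have i3 : ({ω : BondConfig (Fin n) | (A.filter fun a => ω ∈ openConn c a).card ≤ j} ∩ {ω | (A.filter fun a => ω ∈ openConn x a).card ≤ j} :
        Set (BondConfig (Fin n))) = {ω | (A.filter fun a => ω ∈ openConn x a).card ≤ j} ∩ {ω | (A.filter fun a => ω ∈ openConn c a).card ≤ j} :=
      inter_comm _ _
    rw [i1] at s1; rw [i2, ← i3] at s2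
    linarith
  -- step 5: φ ≥ 0 and assembly
  have step5 : ∀ x : Fin n, 0 ≤ φ {x} := fun x => div_nonneg measureReal_nonneg measureReal_nonneg
  have key : 0 ≤ ∑ B ∈ I, (P B - N B) :=
    calc (0 : ℝ) ≤ ∑ x ∈ T, φ {x} * (μ.real {ω : BondConfig (Fin n) | (A.filter fun a => ω ∈ openConn c a).card ≤ j} -
            μ.real {ω : BondConfig (Fin n) | (A.filter fun a => ω ∈ openConn x a).card ≤ j}) :=
          Finset.sum_nonneg fun x hx => mul_nonneg (step5 x) (by linarith [hr x hx])
      _ = ∑ x ∈ T, φ {x} * ∑ B ∈ T.powerset.filter (fun B => x ∈ B), (m B - mb B) :=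
          Finset.sum_congr rfl fun x hx => by rw [step4 x hx]
      _ = ∑ B ∈ I, (∑ x ∈ B, φ {x}) * (m B - mb B) := step3.symm
      _ ≤ ∑ B ∈ I, φ B * (m B - mb B) := Finset.sum_le_sum step2
      _ ≤ ∑ B ∈ I, (P B - N B) := Finset.sum_le_sum step1
  rw [Finset.sum_sub_distrib] at key
  linarith

end GiantKn

end Summit.CriticalPhenomena.PercolationContinuityZ3.Theorems

end
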